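import Mathlib
import HarnessLib
import HarnessLib.Audit
import Summits.NavierStokesRegularity.Statement
import Literature.Analysis.FluidPDE.ClassicalSolution
import Literature.Analysis.FluidPDE.LerayHopf
import Literature.Analysis.FluidPDE.SuitableWeak
import Literature.Analysis.FluidPDE.LocalTypeI
import Literature.Analysis.FluidPDE.LeslieShvydkoy2018MorreyBoundHolds
import Literature.Analysis.FluidPDE.EnstrophySplitting
import Literature.Analysis.FluidPDE.GKPRigidityBackwardUniqueness
import Literature.Analysis.FluidPDE.SelfSimilar
import Literature.Analysis.FluidPDE.LiouvilleExcludesLocalTypeI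
import Summits.NavierStokesRegularity.NavierStokesRegularity.Theses.RootDecompTerminalEnergy
import Summits.NavierStokesRegularity.NavierStokesRegularity.Theses.RootDecompLitSlice
import Summits.NavierStokesRegularity.NavierStokesRegularity.Theorems.TerminalTraceBlowupHasSingularPoint
import Summits.NavierStokesRegularity.NavierStokesRegularity.Theorems.TypeICertificateLadderNoTypeIBlowupTypeIMorrey
import Summits.NavierStokesRegularity.NavierStokesRegularity.Theorems.QuarterJoltTypeIEnergyEquality
import Summits.NavierStokesRegularity.NavierStokesRegularity.Theorems.QuarterJoltNoTerminalJoltPosition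
import Summits.NavierStokesRegularity.NavierStokesRegularity.Theorems.RootDecompLitSliceNoDarkBallClosed
import HarnessLib.Audit.Status.Attr

/-!
Route: RootDecompMorreyBudget

# Route RootDecompMorreyBudget — Root decomposition g3 under N16's critical cell G₂ᴸ — Clay (A) ⟸ P2
∧ J1 ∧ U ∧ T₃ᴸ ∧ H ∧ D ∧ NL — «THE MORREY BUDGET» (re-coordinatise the lineage's critical cell by
the INPUT NORM of the landed Albritton–Barker/Liouville zoom: the ALL-BALLS scaled energy = uniform
local Morrey bound = bounded local Reynolds numbers; the (L)-owned part is routed to the shared core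
NL by kernel, the private remainder is the new, strictly weaker cell H «no supercritical halo»)

ROOT DECOMPOSITION CELL decomp-ns (D-0178/D-0179, RESIDUAL MODE, blocker-first), node booked by
route-writer decomp-ns-writer-1 (g3): the critic-CLEARED lens-6 (g7)
node MorreyBudget («barrier-complement carving»; CRITIC-LEDGER row 80 CLEARED). PARENT POINTER:
refines the BORN N16 `route-NavierStokesRegularity-RootDecompLitSlice`
(DRAFT, commit 70d0ff71) at its critical item G₂ᴸ `LitCriticalSingularityIsTypeI` :29564 — G₂ᴸ is
REPLACED here by H ∧ NL through the EXACT recut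
`litG₂_iff_halo_and_M₂` (given U, T₃ᴸ, D: G₂ᴸ ⟺ H ∧ M₂) and the routing M₂ ⟸ NL (kernel, one `exact`
into the tree's zoom theorem
`Summit.NavierStokesRegularity.NavierStokesRegularity.Theorems.isBackwardBoundedAt_of_morrey_of_not_localTypeISingularityExists`);
P1 = 1217 is
DERIVED from NL (tree
`Summit.NavierStokesRegularity.NavierStokesRegularity.Theorems.noTypeIBlowup_of_not_localTypeISingularityExists`,
landed with TypeICertificateLadder's 2884) instead of being carried; N16's other items are carried
VERBATIM (dedup by signature):
T₃ᴸ 29562, D 29563, U 29565, P2 24827, J1 24829; NL is the existing shared item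
stmt-NavierStokesRegularity-10480 (`NoLocalTypeISingularity`, wanted by
StretchingWellBinding / HalfHolderEnergy; ex-1575) by signature. Concludes the ROOT
`NavierStokesRegularity` (no `--refines` verb; child closing = lens `closes_carved_NL` /
`closes_N16_NL`, HOME/decomp-ns-lens-6/MorreyBudget.lean sha256
bb89210dea9a94c17f4caa39660ce9905d0ffbcf2428747bba827ac3957ea869 (1357 lines; lean rc 0 / 0 err / 0
warn / 0 sorry per lens-6 g7 + critic row 80; statements extracted verbatim by regex in
morrey/spec.py)).

THESIS. It suffices to show X = P2 ∧ J1 ∧ U ∧ T₃ᴸ ∧ H ∧ D ∧ NL. Frame throughout: a maximal smooth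
solution (u, p) of lifespan T > 0, viscosity ν > 0, Leray–Hopf on [0,T]
from its own rapidly decaying datum u(0); «tame» = u(t) → u(T) in L² as t ↑ T; at a vertex x₀ the
terminal SCAR is r⁻¹∫_{B_r(x₀)}|u(T)|², the centred parabolic BUDGET is
sup_{t ∈ (T−r²,T)} r⁻¹∫_{B_r(x₀)}|u(t)|²; the NEW CURRENCY is the ALL-BALLS budget = uniform local
Morrey bound near T, `∃ r₀ M₀ T₁<T, ∀ t ∈ (T₁,T) ∀ x₁ ∀ 0<r≤r₀,
∫_{B_r(x₁)}|u(t)|² ≤ M₀ r` — VERBATIM the hypothesis of the landed zoom theorem; physically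
r⁻¹∫_{B_r}|u|² ≍ (Ur/ν)² is the squared LOCAL REYNOLDS NUMBER of the ball
(ε-regularity = uniformly small local Reynolds numbers; local Type I = uniformly bounded ones; (L) =
bounded-Reynolds-number singularities do not exist).
- H (`NoSupercriticalHalo`, crux r2, NEW CELL, FIRST TARGET when an idea lands; IDEA-NEEDED +
INSTRUMENTABLE): in a tame blow-up, IF every vertex carries a bounded centred
  parabolic budget THEN u is uniformly Morrey-bounded near T. Exact anatomy H ⟺ Hᵤ ∧ Hₛ (asides; BC3
skeleton `NoSupercriticalHalo_of : NoBudgetDrift → NoSubparabolicEddy →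
  NoSupercriticalHalo`): Hᵤ pointwise budgets ⇒ Barker–Prange's uniform top-attached bound
(e.typeI); Hₛ that bound ⇒ the full local Morrey bound (sub-parabolic depth).
  BC5 rung = tree theorem
`Summit.NavierStokesRegularity.NavierStokesRegularity.Theorems.morrey_of_typeI` (rate-Type-I
blow-ups are uniformly Morrey-bounded: H's conclusion holds on the Type-I class, outside S's known
regime).
- NL (`NoLocalTypeISingularity`, crux r3, SHARED CORE = stmt-10480 by signature, ROUTED: NL ⟸ (L)
LANDED `Literature.Analysis.FluidPDE.not_localTypeISingularityExists_of_liouvilleConjectureNS`):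
  no suitable weak solution in a parabolic ball has a backward-singular vertex with
Albritton–Barker's 𝐈 < ∞. NOT weaker than S (all local suitable weak solutions)
  — booked ROUTED/SHARED, never counted as lineage progress; it replaces BOTH N16's G₂ᴸ-door (L) and
N1's blocker P1 (P1 ⟸ NL landed).
- D (`NoDarkBall`, crux r4 = 29563, N16's FIRST PROVER TARGET, skeleton D ⟸ D₁ ∧ D₂ registered
there), T₃ᴸ (`NoLitInvisibleTransient`, crux r5 = 29562, DECLARED RESIDUAL of
  record), U (`NoSupercriticalTameScar`, crux r6 = 29565, DECLARED RESIDUAL, Tao-LOADED), P2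
(`NoEnergyAtom` = 24827), J1 (`AtomFreeBlowupIsTame` = 24829): verbatim.
Lean: `theorem closes (hA : NoEnergyAtom) (hJ1 : AtomFreeBlowupIsTame) (hU :
NoSupercriticalTameScar) (hT : NoLitInvisibleTransient) (hH : NoSupercriticalHalo)
(hD : NoDarkBall) (hNL : NoLocalTypeISingularity) : NavierStokesRegularity` — SEVEN binders, all
consumed (= lens `closes_carved_NL`): N1's `RootDecompTerminalEnergy.closes`
takes P1 (from NL, tree theorem), P2, J1 and E₂; E₂ is rebuilt at a tame first blow-up: D makes
every vertex lit, U bounds its scar, T₃ᴸ its centred budget, H turns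
the family of centred budgets into the uniform Morrey bound, NL + the landed zoom theorem make every
vertex backward bounded, contradicting the backward-singular vertex
of a first blow-up (landed `terminalTrace_blowupHasSingularPoint_proof`, 18382) — so the Type-I
conclusion holds vacuously.

DEPENDENCY SHAPE. Kernel accounting (lens, all sorry-free): S ⟺ P2 ∧ J1 ∧ U ∧ T₃ᴸ ∧ H ∧ D ∧ G^u
(`root_iff_pieces`), ⟺ P2 ∧ J1 ∧ M ∧ G^u (`root_iff_thin`); E₂ ⟺ M ∧ M₂
(`noTameTypeII_iff_morrey`, EXACT AT N1's RESIDUAL); M ⟺ U ∧ T₃ ∧ H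
(`tameBlowupIsMorreyBounded_iff_cells`); H ⟺ Hᵤ ∧ Hₛ; E₂ ⟺ U ∧ T₃ᴸ ∧ T₃ᴰ ∧ H ∧ M₂; THE RECUT
OF 29564: given U, T₃ᴸ, D, G₂ᴸ ⟺ H ∧ M₂, G₂ᴸ ⟸ H ∧ NL, G₂ᴸ ⟸ H under (L); ROUTING G^u ⟸ NL ⟸ (L), M₂
⟸ G^u, P1 ⟸ G^u ⟸ NL (non-vacuously: Type I ⇒ tame + Morrey + singular
vertex); (L) ⇒ (E₂ ⟺ M); file audit of the lens's `closes_N16_L`: UNDER (L) THE ONLY UNREGISTERED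
HYPOTHESIS OF THE WHOLE LINEAGE TREE IS H. Every new piece strictly WEAKER
than S by vacuity (`morreyPieces_of_root`); H WEAKER than G₂ (kernel `noSupercriticalHalo_of_G₂`,
separating class: thin breathers) and than E₂; M₂/G^u WEAKER than E₂/G
(restriction) — ROUTED, not progress; NL NOT weaker (shared core, declared).
THE LEVER (why the recut is not a costume). N16's G₂ᴸ skeleton hid, in its middle stub «an
energy-Type-I vertex that is not backward bounded zooms to a BOUNDED ancient
mild solution», the gap the tree itself records (Literature/Analysis/FluidPDE/LocalTypeI.lean, «Why
a second rendering», item 1): the landed blow-up machine needs the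
scaled energy bounded on ALL small balls (A–B's 𝐈 < ∞), not on the balls centred at the vertex, and
no published argument derives the all-balls bound from the centred
one [corpus:paper-arxiv-1811.00502 p.4 L25 «boundedness of one of (a)–(c_∞) is not known to imply
boundedness of the other quantities»; p.7 Rmk 3.2]. Every currency of
lenses 1–6 (scar, parabolic budget, pace gauges, traces, Morrey cells of the SLICE) is CENTRED and
TOP-ATTACHED: a top-attached bound controls B_ρ(x₁) at time t only
through the ball of radius √(T−t) (quotient ≤ M√(T−t)/ρ, unbounded at SUB-PARABOLIC depth ρ ≪
√(T−t)), while ρ⁻¹∫_{B_ρ}|u(t)|² ≤ |B₁|(T−t)‖u(t)‖²_∞ for ρ² ≤ T−t makes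
every Morrey-fat sub-parabolic ball a TYPE-II-rate event. g7 types exactly this gap as the cell H
and hands everything the Liouville programme already owns (including the
rate-Type-II «thin breathers» that g4–g6 counted as private idea-needed territory G₂ᴸ) to the shared
core NL.

PIECE TAGS (census HOME/census/COSTUME-CENSUS-v4.md sha256
e828b1876d5b3b55654ec8f343ae625c4a0978033b8a85e9ad11ef880e05aa46 (rows for lens-6 g3–g6:
TerminalScar, ParabolicBudget, BernoulliBudget K19 RETIRED, LitSlice); critic CRITIC-LEDGER rows 48
(g4 CLEARED), 63 (g6 CLEARED), 73 (N16 born CLEARED), 80 (g7 MorreyBudget CLEARED); node card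
HOME/decomp-ns-lens-6/NODE-g7.md sha256
3148093068d042a70a5d77685c6a978243561c185282a415805e9235027bf861; probes
HOME/decomp-ns-lens-6/bc/MorreyBudgetProbe{1..6}.lean + .verdicts.txt (H, Hᵤ, Hₛ, G^u, M₂ CLEAN at
batteryMs 90000 — Probe5/6 —, M and NL CLEAN; P5 C → S never closed); U, T₃ᴸ, D, P2, J1 probed CLEAN
at N16's birth (litslice/bc)).
- H `NoSupercriticalHalo` [crux r2 · NEW · WEAKER than S (vacuity; separating class: every blow-up
with a centred-supercritical vertex satisfies H vacuously — Tao's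
  averaged cascade, single-packet cascades C_σ, Hou; rate-Type-I blow-ups satisfy its conclusion)
and than G₂/E₂ (kernel; thin breathers) · Tao-VACUOUS · AveragedTypeI-SILENT
  (caveat (ii)) · NSI-VACUOUS on the Type-II witness ((a/b)^{2j} certificate,
`Caricature.not_typeII_of_morrey_bounded`) but NSI-UNCERTIFIED in general (T-NSI-halo) ·
  violators «halo swarms» (Type-II-rate high-Reynolds micro-eddies at sub-parabolic depth, or
drifting vertex families) MODEL-EMPTY, PRINT-EMPTY ⇒ IDEA-NEEDED +
  INSTRUMENTABLE (T-halo, T-drift, T-NSI-halo) · BC3 skeleton rc 0 (2 stubs Hᵤ, Hₛ) · BC5 rung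
`Summit.NavierStokesRegularity.NavierStokesRegularity.Theorems.morrey_of_typeI`].
- NL `NoLocalTypeISingularity` [crux r3 · SHARED CORE (10480; ex-1575) · ROUTED: NL ⟸ (L) LANDED;
KNOWN sub-cases = the catalogued Type-I exclusions (axisymmetric,
  λ≈1 DSS, Leray self-similar) · NOT WEAKER than S — declared, never sold as progress · carries P1
(landed) and M₂/G^u (kernel)].
- D `NoDarkBall` [crux r4 · = 29563 · ATTACKABLE NOW (N16's registered skeleton D ⟸ D₁ ∧ D₂, engine
plugged)]. T₃ᴸ [crux r5 · = 29562 · DECLARED RESIDUAL of record ·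
  IDEA-NEEDED (visibility order)]. U [crux r6 · = 29565 · DECLARED RESIDUAL · BARRIER: Tao-LOADED].
P2 [= 24827 · provable M]. J1 [= 24829 · N1's residual].
- Asides (outside the cone, never staffed): Hᵤ `NoBudgetDrift`, Hₛ `NoSubparabolicEddy` (H's two
stubs; IDEA-NEEDED; provers on H land them `--supports`); M
  `TameBlowupIsMorreyBounded` (the RESIDUAL BLOCK M ⟺ U ∧ T₃ ∧ H; under (L) M ≡ E₂ — honest
bookkeeping); M₂ `MorreyCriticalSingularityIsTypeI` and G^u
  `NoMorreyCriticalTameSingularity` (the E₂-class restrictions of NL; ROUTED ⟸ NL by kernel; G^u ⟺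
M₂ ∧ P1).
- COSTUME CHECK (critic row 80): M is E₂'s (L)-shadow and says so; G^u/M₂ enter only through NL by
LANDED theorems (booked ROUTED); H ⟸ G₂ is STRICT (thin breathers); H is
  not the tree's S1 «Type-II spikes» remark (cubic currency, one point, sup-form) but the
energy-currency, all-vertex, tame-class CELL with an exact two-cell anatomy.
LEAF TAGS. ATTACKABLE NOW: D (N16), P2. IDEA-NEEDED: H (= Hᵤ ⊕ Hₛ), T₃ᴸ. INSTRUMENTABLE: T-halo,
T-drift, T-NSI-halo (card §Tests). ROUTED/SHARED: NL (the (L) programme).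
BARRIER: U (Tao-LOADED), J1 as in N1.

Rationale: WHY THIS LINE. N1 reduced Clay (A) to P1 ∧ P2 ∧ J1 ∧ E₂; lens-6 g4 cut E₂ ⟺ U ∧ T₃ ∧ G₂ by the
centred scar/budget at the backward-singular vertex; g6 (N16, born) carved
the dark bit (D) and left the lit residual T₃ᴸ ∧ G₂ᴸ with G₂ᴸ «attackable by inheritance through the
Liouville door». g7 reads the door's hinge: the landed
Seregin–Šverák / Albritton–Barker machine
(`Literature/Analysis/FluidPDE/AlbrittonBarkerForwardHolds.lean`; Summits twin
`Summit.NavierStokesRegularity.NavierStokesRegularity.Theorems.isBackwardBoundedAt_of_morrey_of_not_localTypeISingularityExists`)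
consumes the ALL-BALLS scaled energy
(A–B's 𝐈 = sup over all parabolic sub-balls of A + C + D + E [corpus:paper-arxiv-1811.00502 p.3]),
one power of r below Barker–Prange's critical Morrey bound and their
TOP-ATTACHED uniform Type-I condition (e.typeI) [corpus:paper-arxiv-1812.09115 p.4–5]; the centred
budget does not give it (tree LocalTypeI.lean docstring; A–B p.4, Rmk 3.2).
So the critical cell splits EXACTLY into the (L)-owned part (M₂/G^u ⟸ NL, kernel; P1 ⟸ NL landed)
and the new cell H, whose violators no centred or top-attached currency
can see. Imported: ε-regularity / partial regularity bookkeeping (CKN, A–B Lemma 2.6), blow-up zoom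
+ Liouville (KNSS), Leslie–Shvydkoy all-centres budgets for Type I
(landed), Barker–Prange concentration. Sources: HOME/decomp-ns-lens-6/MorreyBudget.lean sha256
bb89210dea9a94c17f4caa39660ce9905d0ffbcf2428747bba827ac3957ea869 (1357 lines; lean rc 0 / 0 err / 0
warn / 0 sorry per lens-6 g7 + critic row 80; statements extracted verbatim by regex in
morrey/spec.py); HOME/decomp-ns-lens-6/NODE-g7.md sha256
3148093068d042a70a5d77685c6a978243561c185282a415805e9235027bf861; arXiv:1811.00502,
arXiv:1812.09115, KNSS2009, SereginSverak2002, LeslieShvydkoy2017, Seregin2014.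
RANKED CRUXES. r2 H `NoSupercriticalHalo` (the new private cell; hardest genuinely-lineage step: no
mechanism bounding sub-parabolic local Reynolds numbers from centred data is
known); r3 NL `NoLocalTypeISingularity` (shared core 10480, routed to the (L) programme); r4 D
`NoDarkBall` (29563, theorem-grade, N16's first target); r5 T₃ᴸ (29562, residual
of record); r6 U (29565, Tao-LOADED residual); r7 P2, r8 J1 (N1 verbatim).
KILL CRITERIA. H refuted-substantive ⟺ a tame blow-up all of whose vertices are
centred-budget-critical but with a «halo swarm» (Type-II-rate micro-eddies of width
ρₖ ≪ √(T−tₖ), energy between ρₖ and √(T−tₖ), at regular points (tₖ,xₖ) → (T,x₀)) or a drifting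
vertex family — kills H and M, leaves NL/D; the lineage then needs a
sub-parabolic currency. NL refuted ⟺ a local Type-I singular suitable weak solution (backward DSS
beyond Tsai/KNSS/Chae–Wolf) — kills NL for every route wanting 10480
and P1's landed reduction with it (the summit very likely false then). T₃ᴸ / U / D kill criteria as
N16. COLLAPSE: to N16 if H turns out provable only through G₂ᴸ itself.
NOT DECOMPOSED YET. H beyond Hᵤ ⊕ Hₛ (both IDEA-NEEDED; instruments T-halo / T-drift first); T₃ᴸ, U
(declared residuals); NL (owned by the (L) programme: TypeILiouville /
StretchingWellBinding lines); D's stubs live on N16.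
CHEAPEST FALSIFIER. T-halo (census, cheap): on the cascade profiles of record (K8/K19) and Hou's
fitted profile tabulate the local Reynolds field Re²(t,x₁,ρ) = ρ⁻¹∫_{B_ρ(x₁)}|u(t)|²
over sub-parabolic ρ ≤ √(T−t): expected argmax at the packet/parabolic scale (no halo) — a halo
signature (argmax at ρ* ≪ √(T−t), value ≫ centred budget) in any candidate
would put H under suspicion; T-NSI-halo (construction question for the NSI critics: finite switched
sub-cascades glued at sub-parabolic depth onto Scheffer's Type-I cascade
— decides whether H is NSI-LOADED).

Novelty: Searches (lens-6 g7 2026-08-30, both corpora; re-read by the writer): tree `rg -n "Morrey|all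
balls|sub-ball|subball|∀ \(x₁" Summits/NavierStokesRegularity/…/{Theses,Theorems}`
+ `lean search 'MorreyBounded|IsBackwardBoundedAt_of_morrey'` → the all-balls Morrey hypothesis
occurs (i) as the HYPOTHESIS of the landed zoom theorem
`Theorems/TypeICertificateLadderNoTypeIBlowupMorrey.lean` (route TypeICertificateLadder derives it
from the GLOBAL Type-I rate, item 2884 PROVED), (ii) in
SelfMixingDichotomy's S1 sup-form files as `subballC` (cubic currency, one point), (iii) in lens-3's
TerminalTrace / RootDecompScarRecut as TOP-TIME Morrey cells
(`MorreyBreakdownsScar`, `MorreyCellCriterion(R)` 18615/23207 — Morrey norms of the slice / of u on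
(T−r²,T), top-attached). No item states «tame ⇒ uniformly
Morrey-bounded near T» (M), the halo cell H or its anatomy Hᵤ/Hₛ; no route books G^u/M₂ (the
E₂-class restriction of NL); born nodes N1–N19 and critic rows 1–81 read.
Corpus (fts+vec+hybrid): «Type I bound sup over all balls r^-1 ∫|u|² ≤ M Barker Prange
concentration» → [corpus:paper-arxiv-1812.09115 p.4–5] (e.typeI) is TOP-ATTACHED, their
full-Morrey remark is the GLOBAL Ṁ^{2,3} bound, sup-rate Type I ⇒ (e.typeI) printed
(Seregin–Zajączkowski; Seregin 2018 pp. 844–849); «local Type I singularity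
Liouville» → [corpus:paper-arxiv-1811.00502 p.3–4, p.7 Rmk 3.2] («boundedness of one of (a)–(c_∞) is
not known to imply boundedness of the other quantities»); vsearch
«NS blow-up Type II in L∞ r  [refs: 10.1007/s00220-021-04122-x, 2304.04045, 2402.13229, 2606.29468, 2510.25448, 1811.00502, 1812.09115, paper-arxiv-1812.09115, paper-arxiv-1811.00502, book-seregin2014-lecture-notes-regularity-theory-navier-stokes-equations, paper-arxiv-2507.08733, doi:10.1007/s00220-021-04122-x]

Barriers (technique_class: halo-swarm recut; eddy anatomy; Reynolds-quotient): - technique_class: halo-swarm recut; eddy anatomy; Reynolds-quotient (ε-regularity bookkeeping in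
the all-balls Morrey currency, blow-up zoom + Liouville routed to
  the shared core NL, Leslie–Shvydkoy / Barker–Prange budgets).
- Literature.Barriers.NavierStokesRegularity.TaoAveragedBlowup / EnergySupercriticality: H, Hᵤ, Hₛ —
VACUOUS (the averaged cascades' vertex is centred-SUPERcritical:
  budget exponent 1 − 2σ > 0 on the single-packet family C_σ, N ≈ 1/50 for Tao's; at the Type-I
endpoint σ = 1/2 the cascade is self-similar and Morrey-bounded, H
  holds); U — INSIDE and LOADED (declared RESIDUAL, no evasion claimed: any proof of U must use the
exact u·∇u algebra); M (aside) LOADED through U; T₃ᴸ vacuous on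
  Tao's cell; NL/G^u/M₂ not averaged-equation arguments (mild bounded ancient NS structure, KNSS).
- Literature.Barriers.NavierStokesRegularity.AveragedTypeIBlowup: H — SILENT (scope caveat (ii):
local all-balls quantities are not functionals of the averaged class);
  G^u/M₂ (asides) INSIDE by design (they contain Type-I exclusion) and DISCHARGED into NL, whose
tree refutation under (L) uses non-averaged structure; NL's known
  sub-cases are exactly Literature.Barriers.NavierStokesRegularity.AxisymmetricTypeIExclusion /
NearOneDssTypeIExclusion / LeraySelfSimilarBlowupExclusion (the PROVED
  part of the ladder, untouched here).
- Literature.Barriers.NavierStokesRegularity.NSITypeIIBlowup and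
Literature.Barriers.NavierStokesRegularity.NavierStokesInequalitySingularSolut

sub-problem: NavierStokesRegularity · status: draft · opened planner-decomp-ns-writer-1-g3-0 2026-08-30T07:34:28Z · rev 0 · ledger route-NavierStokesRegularity-RootDecompMorreyBudget
GENERATED by the gate from the ledger (D-0016/17). Provers cite these decls: `theorem foo : Summit.NavierStokesRegularity.NavierStokesRegularity.Theses.RootDecompMorreyBudget.<Decl> := …` in Summits/NavierStokesRegularity/NavierStokesRegularity/Theorems/<Name>.lean.
-/

namespace Summit.NavierStokesRegularity.NavierStokesRegularity.Theses.RootDecompMorreyBudget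

open scoped BigOperators Topology Manifold Classical MeasureTheory ProbabilityTheory Matrix InnerProductSpace ComplexConjugate ContinuousMap
open Filter Set Function TopologicalSpace MeasureTheory

attribute [summit_statement] _root_.NavierStokesRegularity

open Literature.NS

/-- item stmt-NavierStokesRegularity-30292 · crux · rank 2 · open · by planner
why it might fail: a «halo swarm» — Type-II-rate packets of width r ≪ √(T−t) and energy between r and √(T−t), flaring and dying at regular points (t, x₁) → (T, x₀) — is invisible to every top-attached centred budget
sources: arXiv:1811.00502, arXiv:1812.09115, Seregin2014, SereginSverak2009, CKN1982, LeslieShvydkoy2017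
[crux] H NO SUPERCRITICAL HALO (lens-6 g7; NEW CELL; node N20 under N16's critical item G₂ᴸ =
RootDecompLitSlice.LitCriticalSingularityIsTypeI stmt-29564, recut G₂ᴸ ⟺ H ∧ M₂ given U, T₃ᴸ, D):
for a maximal smooth solution with lifespan T, Leray–Hopf from a rapidly decaying datum, tame at T,
IF every vertex x₀ carries a bounded centred parabolic budget (∃ M r₀, ∀ r < r₀, ∀ t ∈ (T−r²,T),
r⁻¹∫_{B_r(x₀)}|u(t)|² ≤ M) THEN u is uniformly Morrey-bounded near T (∃ r₀ M₀ T₁ < T,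
∫_{B_r(x₁)}|u(t)|² ≤ M₀ r for T₁ < t < T, all x₁, 0 < r ≤ r₀) [tag WEAKER than S (vacuity) and than
G₂/E₂ (kernel; separating class thin breathers) · Tao-VACUOUS, AveragedTypeI-SILENT, NSI-VACUOUS on
the Type-II witness but NSI-UNCERTIFIED in general (T-NSI-halo) · violators «halo swarms»
MODEL-EMPTY, PRINT-EMPTY ⇒ IDEA-NEEDED + INSTRUMENTABLE (T-halo, T-drift) · exact anatomy H ⟺ Hᵤ ∧
Hₛ = BC3 skeleton NoSupercriticalHalo_of : NoBudgetDrift → NoSubparabolicEddy → NoSupercriticalHalo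
(rc 0, sorries = 2 stubs) · BC5 rung = tree theorem Theorems.morrey_of_typeI (H's conclusion on the
rate-Type-I class)] -/
@[route_item "route-NavierStokesRegularity-RootDecompMorreyBudget", crux]
def NoSupercriticalHalo : Prop :=
  ∀ (ν T : ℝ), 0 < ν → 0 < T → ∀ (u : ℝ → EuclideanSpace ℝ (Fin 3) → EuclideanSpace ℝ (Fin 3)) (p : ℝ → EuclideanSpace ℝ (Fin 3) → ℝ), Literature.Analysis.FluidPDE.IsMaximalSmoothSolution ν 0 u p T → Literature.Analysis.FluidPDE.IsLerayHopfOn T ν 0 (u 0) u → Literature.Analysis.FluidPDE.HasRapidSpatialDecay (u 0) → Filter.Tendsto (fun t => MeasureTheory.eLpNorm (u t - u T) 2 MeasureTheory.volume) (nhdsWithin T (Set.Iio T)) (nhds 0) → (∀ x₀ : EuclideanSpace ℝ (Fin 3), ∃ M r₀ : ℝ, 0 < r₀ ∧ ∀ r ∈ Set.Ioo 0 r₀, ∀ t ∈ Set.Ioo (T - r ^ 2) T, r⁻¹ * ∫ x in Metric.ball x₀ r, ‖u t x‖ ^ 2 ≤ M) → ∃ r₀ M₀ T₁ : ℝ, 0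 < r₀ ∧ T₁ < T ∧ ∀ t ∈ Set.Ioo T₁ T, ∀ (x₁ : EuclideanSpace ℝ (Fin 3)) (r : ℝ), 0 < r → r ≤ r₀ → ∫ x in Metric.ball x₁ r, ‖u t x‖ ^ 2 ≤ M₀ * r

/-- item stmt-NavierStokesRegularity-10480 · crux · rank 3 · open · by planner
why it might fail: it is refuted by any Type-I singular suitable weak solution (e.g. a backward discretely self-similar one beyond Tsai/KNSS/Chae–Wolf); the Liouville conjecture for bounded mild ancient solutions is open
sources: arXiv:1811.00502, KNSS2009, Seregin2006, arXiv:2006.04140, Tsai1998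
[crux] No Type-I singular point: the first bullet of Albritton-Barker 2019 Thm 1.1 NEGATED - no
suitable weak solution (nu=1) in a parabolic ball Q(z,r0) has its centre as a backward singular
point with AB's Type-I quantity I(Q(z,r0)) = sup over parabolic sub-balls of A+C+D+E finite.
RESTATED 2026-08-15 (route-repair, staffability): the body of the registered open statement
Literature.Analysis.FluidPDE.LocalTypeISingularityExists (LocalTypeI.lean, [status: open]) is
INLINED over the printed notion IsLocalTypeISingularPoint, so that no closed unproved Literature
Prop sits in the route's used-constants cone; the item is Iff.rfl-equal to `¬
LocalTypeISingularityExists` (planner Check.lean rc 0), so every in-tree lemma about that name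
applies verbatim (e.g. refutation via
localTypeISingularityExists_of_nontrivialMildAncientTypeIExists). Status: OPEN; expected TRUE under
the KNSS Liouville conjecture (L) (stmt-0057, route TypeILiouville) via AB's forward direction
(named fact AlbrittonBarkerForward = Seregin-Sverak rescaling) and equivalent, under that fact, to
(L') = not NontrivialMildAncientTypeIExists (AB reverse direction PROVED in tree). Known cases:
axisymmetric (SereginSverak2009 -/
@[route_item "route-NavierStokesRegularity-RootDecompMorreyBudget", crux]
def NoLocalTypeISingularity : Prop :=
  ¬ ∃ (r₀ : ℝ) (z : ℝ × EuclideanSpace ℝ (Fin 3)) (u : ℝ → EuclideanSpace ℝ (Fin 3) → EuclideanSpace ℝ (Fin 3)) (p : ℝ → EuclideanSpace ℝ (Fin 3) → ℝ), Literature.Analysis.FluidPDE.IsLocalTypeISingularPoint r₀ z u p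

/-- item stmt-NavierStokesRegularity-29563 · crux · rank 4 · closed · proved by Summit.NavierStokesRegularity.NavierStokesRegularity.Theorems.noDarkBall (planner) · by planner
why it might fail: only if slice unique continuation broke at the boundary of the regular region — a blow-up whose vorticity support at time T retreats from a ball while staying singular on its rim (no model, NS or NSI-free, known)
sources: arXiv:math/0611462, EscauriazaSereginSverak2003, GKP2016, CKN1982, arXiv:1802.03164, arXiv:1809.02109
[crux] D NO DARK BALL ON THE TERMINAL SLICE OF A FIRST BLOW-UP (lens-6 g6; NEW; TAME-FREE; FIRST
PROVER TARGET): for a maximal smooth solution with lifespan T, Leray–Hopf on [0,T] from a rapidly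
decaying datum, the terminal slice u(T) (pinned a.e. by weak L²-continuity) does not vanish a.e. on
any ball [tag WEAKER than S (vacuity; separating class: every LIT blow-up model) · EVICTS every
printed NSI blow-up (all energy-extinct at T₀) from the lineage's cells · ATTACKABLE NOW: BC3
skeleton NoDarkBall_of : DarkBallSpreads → NoGlobalExtinction → NoDarkBall (kernel = lens
`noDarkBall_of_spreads`); engines: CKN slice nullity, EFV two-sphere one-cylinder at regular slice
points, harmonic identity theorem, a.e.-ray GMT (D₁); far-field bounds + LANDED
`IsClassicalNSSolutionOn.curl_eq_zero_of_farField_of_tendsto` + L² Liouville + extension by zero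
(D₂; plug PROVED = BC5 rung `curl_eq_zero_of_extinct_of_farField`)] -/
@[route_item "route-NavierStokesRegularity-RootDecompMorreyBudget", crux]
def NoDarkBall : Prop :=
  ∀ (ν T : ℝ), 0 < ν → 0 < T → ∀ (u : ℝ → EuclideanSpace ℝ (Fin 3) → EuclideanSpace ℝ (Fin 3)) (p : ℝ → EuclideanSpace ℝ (Fin 3) → ℝ), Literature.Analysis.FluidPDE.IsMaximalSmoothSolution ν 0 u p T → Literature.Analysis.FluidPDE.IsLerayHopfOn T ν 0 (u 0) u → Literature.Analysis.FluidPDE.HasRapidSpatialDecay (u 0) → ∀ (x₀ : EuclideanSpace ℝ (Fin 3)) (ρ : ℝ), 0 < ρ → ¬ (∀ᵐ x ∂(MeasureTheory.volume.restrict (Metric.ball x₀ ρ)), u T x = 0)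

/-- `NoDarkBall` holds: proved by `Summit.NavierStokesRegularity.NavierStokesRegularity.Theorems.noDarkBall`. -/
theorem NoDarkBall_holds : NoDarkBall := _root_.Summit.NavierStokesRegularity.NavierStokesRegularity.Theorems.noDarkBall

/-- item stmt-NavierStokesRegularity-29562 · crux · rank 5 · open · by planner
why it might fail: a lit self-erasing Type-II transient — supercritical energy sweeping B_r(x₀)×(T−r²,T) at every scale, leaving a faint non-zero trace at T (visibility order in (1,∞)) — is tame and boundedly scarred
sources: arXiv:1709.00602, arXiv:1809.02109, CKN1982, LeslieShvydkoy2017, Seregin2014, arXiv:1402.0290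
[crux] T₃ᴸ NO LIT INVISIBLE TRANSIENT (lens-6 g6; node N16 under N1's residual E₂ =
RootDecompTerminalEnergy.NoTameTypeII stmt-24828; DECLARED RESIDUAL): for a maximal smooth solution
with lifespan T, Leray–Hopf from a rapidly decaying datum, TAME at T (u(t) → u(T) in L²), at every
LIT vertex x₀ (u(T) vanishes a.e. on no ball around x₀) whose terminal scar r⁻¹∫_{B_r}|u(T)|² is
bounded, the parabolic budget sup_{t∈(T−r²,T)} r⁻¹∫_{B_r}|u(t)|² is bounded [tag WEAKER than g4's T₃
(restriction) and than S (vacuity); ≡ T₃ GIVEN D (kernel T₃ ⟺ T₃ᴸ ∧ T₃ᴰ, D ⟹ T₃ᴰ) · NSI-UNCERTIFIED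
after the carving (every printed NSI witness is dark) · Tao-VACUOUS · IDEA-NEEDED (visibility-order
lower bound) · INSTRUMENTABLE · never a prover target before an idea lands] -/
@[route_item "route-NavierStokesRegularity-RootDecompMorreyBudget", crux]
def NoLitInvisibleTransient : Prop :=
  ∀ (ν T : ℝ), 0 < ν → 0 < T → ∀ (u : ℝ → EuclideanSpace ℝ (Fin 3) → EuclideanSpace ℝ (Fin 3)) (p : ℝ → EuclideanSpace ℝ (Fin 3) → ℝ), Literature.Analysis.FluidPDE.IsMaximalSmoothSolution ν 0 u p T → Literature.Analysis.FluidPDE.IsLerayHopfOn T ν 0 (u 0) u → Literature.Analysis.FluidPDE.HasRapidSpatialDecay (u 0) → Filter.Tendsto (fun t => MeasureTheory.eLpNorm (u t - u T) 2 MeasureTheory.volume) (nhdsWithin T (Set.Iio T)) (nhds 0) → ∀ x₀ : EuclideanSpace ℝ (Fin 3), ¬ (∃ ρ : ℝ, 0 < ρ ∧ ∀ᵐ x ∂(MeasureTheory.volume.restrict (Metric.ball x₀ ρ)), u T x = 0) → (∃ M r₁ : ℝ, 0 < r₁ ∧ ∀ r ∈ Set.Ioo 0 r₁, r⁻¹ *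 ∫ x in Metric.ball x₀ r, ‖u T x‖ ^ 2 ≤ M) → ∃ M r₀ : ℝ, 0 < r₀ ∧ ∀ r ∈ Set.Ioo 0 r₀, ∀ t ∈ Set.Ioo (T - r ^ 2) T, r⁻¹ * ∫ x in Metric.ball x₀ r, ‖u t x‖ ^ 2 ≤ M

/-- item stmt-NavierStokesRegularity-29565 · crux · rank 6 · open · by planner
why it might fail: a tame blow-up whose terminal slice carries a supercritical scar |u(T,x)| ~ |x−x₀|^{-a}, a > 1 (Tao's averaged cascade made exact: N ≈ 1/50) — tame, lit, scar unbounded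
sources: arXiv:1402.0290, LeslieShvydkoy2017, CKN1982, arXiv:1709.00602
[crux] U NO SUPERCRITICAL TAME SCAR (lens-6 g4 ParabolicBudget piece VERBATIM, CLEARED critic row
48, first birth here; DECLARED RESIDUAL — Tao-LOADED): for a maximal smooth solution with lifespan
T, Leray–Hopf from a rapidly decaying datum, tame at T, the terminal scar r⁻¹∫_{B_r(x₀)}|u(T)|² is
bounded as r ↓ 0 at every vertex x₀ [tag WEAKER than E₂ (Type I ⟹ budget ⟹ scar, Leslie–Shvydkoy
landed; kernel `noSupercriticalTameScar_of_noTameTypeII`) and than S (vacuity) · unchanged by g6 (a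
dark vertex has scar 0, `scar_of_dark`: U's separating class is lit already) · BARRIER: LOADED by
Tao's averaged cascade (tame-compatible, supercritically scarred, visibility order ≈ 1/50) — any
proof must use the exact u·∇u algebra · never a prover target before an idea lands] -/
@[route_item "route-NavierStokesRegularity-RootDecompMorreyBudget", crux]
def NoSupercriticalTameScar : Prop :=
  ∀ (ν T : ℝ), 0 < ν → 0 < T → ∀ (u : ℝ → EuclideanSpace ℝ (Fin 3) → EuclideanSpace ℝ (Fin 3)) (p : ℝ → EuclideanSpace ℝ (Fin 3) → ℝ), Literature.Analysis.FluidPDE.IsMaximalSmoothSolution ν 0 u p T → Literature.Analysis.FluidPDE.IsLerayHopfOn T ν 0 (u 0) u → Literature.Analysis.FluidPDE.HasRapidSpatialDecay (u 0) → Filter.Tendsto (fun t => MeasureTheory.eLpNorm (u t - u T) 2 MeasureTheory.volume) (nhdsWithin T (Set.Iio T)) (nhds 0) → ∀ x₀ : EuclideanSpace ℝ (Fin 3), ∃ M r₁ : ℝ, 0 < r₁ ∧ ∀ r ∈ Set.Ioo 0 r₁, r⁻¹ * ∫ x in Metric.ball x₀ r, ‖u T x‖ ^ 2 ≤ M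

/-- item stmt-NavierStokesRegularity-24827 · crux · rank 7 · open · by planner
why it might fail: it should not — CKN partial regularity gives it; only the typed limsup/ball form could be mis-stated
sources: CKN1982, arXiv:0709.3599
[crux] P2 — NO ENERGY ATOM AT A FRAME TIME [the ATTACKED cell; = registered stub `stub_noEnergyAtom`
of crux stmt-19625 (Cruxes/WeakLambdaCriterion/Lines/birth.lean) VERBATIM, reused not re-invented;
tag WEAKER(evidence: 0056 ⇒ P2 KERNEL `noEnergyAtom_of_typeIIEnergyEquality`; S ⇒ P2 KERNEL (critic
`noEnergyAtom_of_root`, writer `noEnergyAtom_of_noBlowup`); in-NS separating classes where P2 is a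
THEOREM: rate β<3/5 `leslieShvydkoy2018_noConcentration_of_rate`, Type I
`noEnergyAtom_of_isTypeIBlowup`, enstrophy α<4/5 `noEnergyAtom_of_enstrophyRate` — critic CLEARED
2026-08-30T01:32:55Z, CRITIC-LEDGER row 7); leaf ATTACKABLE-by-inheritance (LS18/CKN engine; open =
LS18 Question 1.1 at dimension 0, arXiv:1705.04420 p.4) + INSTRUMENTABLE (exponent test: an atom
needs sup-rate β ≥ 3/5 and core radius γ ≤ 2β/3; Tao band test); BC5 rung LANDED: Type-I case
`Theorems.NoTerminalJolt.noEnergyAtom_of_isTypeIBlowup`]: a classical NS solution on ℝ³×[0,T) (zero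
force), Leray–Hopf on [0,T] from its rapidly decaying datum, deposits no energy atom at time T: ∀x₀
∀η>0 ∃r>0, ∫_{B_r(x₀)}|u(t)|² < η for all t<T close to T. [difficulty: open-problem] -/
@[route_item "route-NavierStokesRegularity-RootDecompMorreyBudget", crux]
def NoEnergyAtom : Prop :=
  ∀ (ν T : ℝ), 0 < ν → 0 < T → ∀ (u : ℝ → EuclideanSpace ℝ (Fin 3) → EuclideanSpace ℝ (Fin 3)) (p : ℝ → EuclideanSpace ℝ (Fin 3) → ℝ), Literature.Analysis.FluidPDE.IsClassicalNSSolutionOn (Set.Ico 0 T) ν 0 u p → Literature.Analysis.FluidPDE.IsLerayHopfOn T ν 0 (u 0) u → Literature.Analysis.FluidPDE.HasRapidSpatialDecay (u 0) → ∀ (x₀ : EuclideanSpace ℝ (Fin 3)) (η : NNReal), 0 < η → ∃ r : ℝ, 0 < r ∧ ∀ᶠ t in nhdsWithin T (Set.Iio T), ∫⁻ x in Metric.ball x₀ r, ‖u t x‖ₑ ^ 2 < (η : ENNReal)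

/-- item stmt-NavierStokesRegularity-24829 · crux · rank 8 · open · by planner
why it might fail: a wild (non-L²-convergent) first blow-up without energy concentration at a point — energy escaping to a fractal terminal set (lens-5 Frostman axis)
sources: CKN1982, arXiv:2107.06509
[crux] J1 — AN ATOM-FREE FIRST BLOW-UP IS TAME [lens-2 J1 VERBATIM; RESIDUAL diffuse-dust cell; tag
WEAKER(evidence: E₁/18118 ⇒ J1 trivially, 0056 ⇒ J1 kernel via LS18 Thm 1.2 landed; separating
classes: atomic collapses and tame Type-II spikes, alive; omitted cell never constructed even in the
NSI relaxation — Scheffer/Ożański cascades are defect-free); leaf IDEA-NEEDED (GMT of the energy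
measure on the compact 𝓗¹-null singular slice Σ_T + dynamics; no named engine) — critic CLEARED
2026-08-30T01:32:55Z row 7 as the middle cell]: a maximal smooth solution with lifespan T,
Leray–Hopf from a rapidly decaying datum, which deposits no energy atom at T, has ‖u(t) − u(T)‖_{L²}
→ 0 as t ↑ T (NS cannot smear a positive energy quantum over an uncountable 𝓗¹-null dust). [deps:
NoEnergyAtom] [difficulty: open-problem] -/
@[route_item "route-NavierStokesRegularity-RootDecompMorreyBudget", crux]
def AtomFreeBlowupIsTame : Prop :=
  ∀ (ν T : ℝ), 0 < ν → 0 < T → ∀ (u : ℝ → EuclideanSpace ℝ (Fin 3) → EuclideanSpace ℝ (Fin 3)) (p : ℝ → EuclideanSpace ℝ (Fin 3) → ℝ), Literature.Analysis.FluidPDE.IsMaximalSmoothSolution ν 0 u p T → Literature.Analysis.FluidPDE.IsLerayHopfOn T ν 0 (u 0) u → Literature.Analysis.FluidPDE.HasRapidSpatialDecay (u 0) → (∀ (x₀ : EuclideanSpace ℝ (Fin 3)) (η : NNReal), 0 < η → ∃ r : ℝ, 0 < r ∧ ∀ᶠ t in nhdsWithin T (Set.Iio T), ∫⁻ x in Metric.ball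 x₀ r, ‖u t x‖ₑ ^ 2 < (η : ENNReal)) → Filter.Tendsto (fun t => MeasureTheory.eLpNorm (u t - u T) 2 MeasureTheory.volume) (nhdsWithin T (Set.Iio T)) (nhds 0)

/-- item stmt-NavierStokesRegularity-30293 · aside · rank 9 · open · by planner
why it might fail: pointwise-in-vertex bounds with constants degenerating along a sequence of vertices xₖ → x₀ are compatible with a bounded budget at x₀ itself
sources: arXiv:1812.09115, arXiv:1811.00502, CKN1982, Seregin2014
[aside] Hᵤ NO BUDGET DRIFT ACROSS VERTICES — STUB 1 of H's birth skeleton (`stub_noBudgetDrift`; H ⟺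
Hᵤ ∧ Hₛ kernel; provers on H land it `--supports`): in a tame blow-up, pointwise bounded centred
budgets at every vertex ⇒ Barker–Prange's UNIFORM top-attached bound ∃ r₀ M, ∫_{B_r(x₁)}|u(t)|² ≤ M
r for all x₁, r < r₀, T − r² < t < T ((e.typeI), arXiv:1812.09115 p.4, squared) [WEAKER than H;
violators «drifting vertex families» (budgets M(x₀) → ∞ / radii r₀(x₀) → 0 along vertices
accumulating at a vertex) MODEL-EMPTY, PRINT-EMPTY ⇒ IDEA-NEEDED (T-drift); Tao-VACUOUS,
NSI-UNCERTIFIED] -/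
@[route_item "route-NavierStokesRegularity-RootDecompMorreyBudget"]
def NoBudgetDrift : Prop :=
  ∀ (ν T : ℝ), 0 < ν → 0 < T → ∀ (u : ℝ → EuclideanSpace ℝ (Fin 3) → EuclideanSpace ℝ (Fin 3)) (p : ℝ → EuclideanSpace ℝ (Fin 3) → ℝ), Literature.Analysis.FluidPDE.IsMaximalSmoothSolution ν 0 u p T → Literature.Analysis.FluidPDE.IsLerayHopfOn T ν 0 (u 0) u → Literature.Analysis.FluidPDE.HasRapidSpatialDecay (u 0) → Filter.Tendsto (fun t => MeasureTheory.eLpNorm (u t - u T) 2 MeasureTheory.volume) (nhdsWithin T (Set.Iio T)) (nhds 0) → (∀ x₀ : EuclideanSpace ℝ (Fin 3), ∃ M r₀ : ℝ, 0 < r₀ ∧ ∀ r ∈ Set.Ioo 0 r₀, ∀ t ∈ Set.Ioo (T - r ^ 2) T, r⁻¹ * ∫ x in Metric.ball x₀ r, ‖u t x‖ ^ 2 ≤ M) → ∃ r₀ M : ℝ, 0 < r₀ ∧ ∀ (x₁ : EuclideanSpace ℝ (Fin 3)), ∀ r ∈ Set.Ioo 0 r₀, ∀ t ∈ Set.Ioo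 (T - r ^ 2) T, ∫ x in Metric.ball x₁ r, ‖u t x‖ ^ 2 ≤ M * r

/-- item stmt-NavierStokesRegularity-30294 · aside · rank 9 · open · by planner
why it might fail: a swarm of Type-II-rate micro-eddies of width ρₖ ≪ √(T−tₖ), flaring and decaying before T at points (tₖ,xₖ) → (T,x₀), costs a top-attached observer nothing
sources: arXiv:1812.09115, arXiv:1811.00502, SereginSverak2009, LeslieShvydkoy2017
[aside] Hₛ NO SUB-PARABOLIC EDDY SWARM — STUB 2 of H's birth skeleton (`stub_noSubparabolicEddy`):
in a tame blow-up, Barker–Prange's uniform top-attached Type-I bound ⇒ the full uniform local Morrey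
bound near T (all balls r ≤ r₀ at all times T₁ < t < T) [WEAKER than H; violators «sub-parabolic
eddy swarms» (balls B_ρ(x₁) with ρ² < T − t carrying ∫|u(t)|² ≫ ρ, necessarily at TYPE-II sup-rate
times) MODEL-EMPTY, PRINT-EMPTY (Albritton–Barker §1 p.4, Rmk 3.2) ⇒ IDEA-NEEDED + INSTRUMENTABLE
(T-halo, T-NSI-halo); Tao-VACUOUS, NSI-UNCERTIFIED] -/
@[route_item "route-NavierStokesRegularity-RootDecompMorreyBudget"]
def NoSubparabolicEddy : Prop :=
  ∀ (ν T : ℝ), 0 < ν → 0 < T → ∀ (u : ℝ → EuclideanSpace ℝ (Fin 3) → EuclideanSpace ℝ (Fin 3)) (p : ℝ → EuclideanSpace ℝ (Fin 3) → ℝ), Literature.Analysis.FluidPDE.IsMaximalSmoothSolution ν 0 u p T → Literature.Analysis.FluidPDE.IsLerayHopfOn T ν 0 (u 0) u → Literature.Analysis.FluidPDE.HasRapidSpatialDecay (u 0) → Filter.Tendsto (fun t => MeasureTheory.eLpNorm (u t - u T) 2 MeasureTheory.volume) (nhdsWithin T (Set.Iio T)) (nhds 0) → (∃ r₀ M : ℝ,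 0 < r₀ ∧ ∀ (x₁ : EuclideanSpace ℝ (Fin 3)), ∀ r ∈ Set.Ioo 0 r₀, ∀ t ∈ Set.Ioo (T - r ^ 2) T, ∫ x in Metric.ball x₁ r, ‖u t x‖ ^ 2 ≤ M * r) → ∃ r₀ M₀ T₁ : ℝ, 0 < r₀ ∧ T₁ < T ∧ ∀ t ∈ Set.Ioo T₁ T, ∀ (x₁ : EuclideanSpace ℝ (Fin 3)) (r : ℝ), 0 < r → r ≤ r₀ → ∫ x in Metric.ball x₁ r, ‖u t x‖ ^ 2 ≤ M₀ * r

/-- item stmt-NavierStokesRegularity-30295 · aside · rank 9 · open · by planner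
why it might fail: any violator of U, T₃ or H violates M (Tao's cascade made exact; lit self-erasing transients; halo swarms)
sources: arXiv:1811.00502, arXiv:1812.09115, LeslieShvydkoy2017, arXiv:1402.0290
[aside] M TAME BLOW-UP IS UNIFORMLY MORREY-BOUNDED NEAR T — the RESIDUAL BLOCK of the g7 cut (E₂ ⟺ M
∧ M₂; M ⟺ U ∧ T₃ ∧ H ⟺ U ∧ T₃ ∧ Hᵤ ∧ Hₛ; under (L) M ≡ E₂ — honest bookkeeping, recorded for
exactness, never staffed): a tame first blow-up keeps all its small eddies at bounded local Reynolds
number [WEAKER than S (vacuity) and than E₂; Tao-LOADED via U; violated by the NSI Type-II witness,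
satisfied by rate-Type-I blow-ups (Leslie–Shvydkoy)] -/
@[route_item "route-NavierStokesRegularity-RootDecompMorreyBudget"]
def TameBlowupIsMorreyBounded : Prop :=
  ∀ (ν T : ℝ), 0 < ν → 0 < T → ∀ (u : ℝ → EuclideanSpace ℝ (Fin 3) → EuclideanSpace ℝ (Fin 3)) (p : ℝ → EuclideanSpace ℝ (Fin 3) → ℝ), Literature.Analysis.FluidPDE.IsMaximalSmoothSolution ν 0 u p T → Literature.Analysis.FluidPDE.IsLerayHopfOn T ν 0 (u 0) u → Literature.Analysis.FluidPDE.HasRapidSpatialDecay (u 0) → Filter.Tendsto (fun t => MeasureTheory.eLpNorm (u t - u T) 2 MeasureTheory.volume) (nhdsWithin T (Set.Iio T)) (nhds 0) → ∃ r₀ M₀ T₁ : ℝ, 0 < r₀ ∧ T₁ < T ∧ ∀ t ∈ Set.Ioo T₁ T, ∀ (x₁ : EuclideanSpace ℝ (Fin 3)) (r : ℝ), 0 < r → r ≤ r₀ → ∫ x in Metric.ball x₁ r, ‖u t x‖ ^ 2 ≤ M₀ * r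

/-- item stmt-NavierStokesRegularity-30296 · aside · rank 9 · open · by planner
why it might fail: a thin breather — uniformly Morrey-bounded (energy-Type-I on all balls) yet with sup|u|√(T−t) unbounded along a sequence — is tame, singular and Type II; 𝐈 < ∞ ⇒ sup-rate is not in print (A–B Rmk 3.2)
sources: arXiv:1811.00502, Seregin2014, SereginSverak2009, arXiv:2006.04140, BarkerPrange2021
[aside] M₂ A TAME MORREY-BOUNDED BLOW-UP WITH A SINGULAR VERTEX IS TYPE I — the E₂-class restriction
of NL (E₂ ⟺ M ∧ M₂; ROUTED: M₂ ⟸ G^u ⟸ NL kernel, M₂ ⟸ G₂ kernel; recorded for the exact recut G₂ᴸ ⟺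
H ∧ M₂ of 29564; never staffed separately — its attack is the (L) programme) [WEAKER than S, than E₂
and than G₂ (separating class halo vertices)] -/
@[route_item "route-NavierStokesRegularity-RootDecompMorreyBudget"]
def MorreyCriticalSingularityIsTypeI : Prop :=
  ∀ (ν T : ℝ), 0 < ν → 0 < T → ∀ (u : ℝ → EuclideanSpace ℝ (Fin 3) → EuclideanSpace ℝ (Fin 3)) (p : ℝ → EuclideanSpace ℝ (Fin 3) → ℝ), Literature.Analysis.FluidPDE.IsMaximalSmoothSolution ν 0 u p T → Literature.Analysis.FluidPDE.IsLerayHopfOn T ν 0 (u 0) u → Literature.Analysis.FluidPDE.HasRapidSpatialDecay (u 0) → Filter.Tendsto (fun t => MeasureTheory.eLpNorm (u t - u T) 2 MeasureTheory.volume) (nhdsWithin T (Set.Iio T)) (nhds 0) → (∃ r₀ M₀ T₁ : ℝ, 0 < r₀ ∧ T₁ < T ∧ ∀ t ∈ Set.Ioo T₁ T, ∀ (x₁ : EuclideanSpace ℝ (Fin 3)) (r : ℝ), 0 < r → r ≤ r₀ → ∫ x in Metric.ball x₁ r, ‖u t x‖ ^ 2 ≤ M₀ * r) → (∃ x₀ :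 EuclideanSpace ℝ (Fin 3), ¬ (∃ r > 0, ∃ C : ℝ, ∀ t ∈ Set.Ioo (T - r ^ 2) T, ∀ x ∈ Metric.ball x₀ r, ‖u t x‖ ≤ C)) → Literature.Analysis.FluidPDE.IsTypeIBlowup u T

/-- item stmt-NavierStokesRegularity-30297 · aside · rank 9 · open · by planner
why it might fail: a Type-I blow-up (backward DSS profile beyond Tsai/KNSS, or a thin breather) is tame, uniformly Morrey-bounded (Leslie–Shvydkoy) and singular somewhere; (L) is open
sources: arXiv:1811.00502, KNSS2009, SereginSverak2002, Seregin2006, LeslieShvydkoy2017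
[aside] G^u NO MORREY-CRITICAL TAME SINGULARITY — tame ∧ uniformly Morrey-bounded ⇒ backward bounded
at every vertex (ROUTED: G^u ⟸ NL by one `exact` into the tree's zoom theorem; G^u ⟺ M₂ ∧ P1, G^u ⟹
P1 non-vacuously; recorded for the lens's 7-binder `closes` P2 J1 U T₃ᴸ H D G^u and the exactness S
⟺ P2 ∧ J1 ∧ U ∧ T₃ᴸ ∧ H ∧ D ∧ G^u; never staffed separately) [WEAKER than S (vacuity; separating
class every Morrey-supercritical blow-up) and than G₂ ∧ P1] -/
@[route_item "route-NavierStokesRegularity-RootDecompMorreyBudget"]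
def NoMorreyCriticalTameSingularity : Prop :=
  ∀ (ν T : ℝ), 0 < ν → 0 < T → ∀ (u : ℝ → EuclideanSpace ℝ (Fin 3) → EuclideanSpace ℝ (Fin 3)) (p : ℝ → EuclideanSpace ℝ (Fin 3) → ℝ), Literature.Analysis.FluidPDE.IsMaximalSmoothSolution ν 0 u p T → Literature.Analysis.FluidPDE.IsLerayHopfOn T ν 0 (u 0) u → Literature.Analysis.FluidPDE.HasRapidSpatialDecay (u 0) → Filter.Tendsto (fun t => MeasureTheory.eLpNorm (u t - u T) 2 MeasureTheory.volume) (nhdsWithin T (Set.Iio T)) (nhds 0) → (∃ r₀ M₀ T₁ : ℝ, 0 < r₀ ∧ T₁ < T ∧ ∀ t ∈ Set.Ioo T₁ T, ∀ (x₁ : EuclideanSpace ℝ (Fin 3)) (r : ℝ), 0 < r → r ≤ r₀ → ∫ x in Metric.ball x₁ r, ‖u t x‖ ^ 2 ≤ M₀ * r) → ∀ x₀ : EuclideanSpace ℝ (Fin 3), ∃ r > 0, ∃ C : ℝ, ∀ t ∈ Set.Ioo (T - r ^ 2) T, ∀ x ∈ Metric.ball x₀ r, ‖u t x‖ ≤ 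C

/-- item stmt-NavierStokesRegularity-30298 · assembly · rank 1 · open · by planner
sources: Fefferman2000, CKN1982, arXiv:1811.00502
[assembly] the implication the glue proves: P2 → J1 → U → T₃ᴸ → H → D → NL → Clay (A) (all seven
consumed; = lens `closes_carved_NL` / `closes_N16_NL` through N1's
`RootDecompTerminalEnergy.closes`, with P1 from NL by the tree theorem and E₂ rebuilt from U, T₃ᴸ,
H, D, NL via the landed zoom theorem). -/
@[route_item "route-NavierStokesRegularity-RootDecompMorreyBudget"]
def Assembly : Prop :=
  NoEnergyAtom → AtomFreeBlowupIsTame → NoSupercriticalTameScar → NoLitInvisibleTransient → NoSupercriticalHalo → NoDarkBall → NoLocalTypeISingularity → NavierStokesRegularity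

/-! D-0027 §2.1 — DECIDING THEOREM (planner-authored via `route open/edit --closes-file`; by planner-decomp-ns-writer-1-g3-0 2026-08-30T07:34:28Z):
its hypotheses are this route's items and its conclusion the sub-problem Statement (glue_lint), and it elaborates with this file. -/

@[closes "route-NavierStokesRegularity-RootDecompMorreyBudget"] theorem closes (hA : NoEnergyAtom) (hJ1 : AtomFreeBlowupIsTame) (hU : NoSupercriticalTameScar)
    (hT : NoLitInvisibleTransient) (hH : NoSupercriticalHalo) (hD : NoDarkBall)
    (hNL : NoLocalTypeISingularity) : NavierStokesRegularity := by
  refine Summit.NavierStokesRegularity.NavierStokesRegularity.Theses.RootDecompTerminalEnergy.closes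
    (Summit.NavierStokesRegularity.NavierStokesRegularity.Theorems.noTypeIBlowup_of_not_localTypeISingularityExists hNL) hA hJ1 ?_
  intro ν T hν hT' u p hmax hLH hdec htame
  obtain ⟨r₀, M₀, T₁, hr₀, hT₁, hMor⟩ := hH ν T hν hT' u p hmax hLH hdec htame (fun x₀ =>
    hT ν T hν hT' u p hmax hLH hdec htame x₀
      (fun hdark => hdark.elim fun ρ hρ => hD ν T hν hT' u p hmax hLH hdec x₀ ρ hρ.1 hρ.2)
      (hU ν T hν hT' u p hmax hLH hdec htame x₀))
  obtain ⟨xs, hxs⟩ :=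
    Summit.NavierStokesRegularity.NavierStokesRegularity.Theorems.terminalTrace_blowupHasSingularPoint_proof
      ν T hν hT' u p hmax.1 hLH hdec hmax.2
  obtain ⟨r, hr, C, hC⟩ :=
    Summit.NavierStokesRegularity.NavierStokesRegularity.Theorems.isBackwardBoundedAt_of_morrey_of_not_localTypeISingularityExists hNL hν hT' hmax.1 hLH hr₀ hT₁ hMor xs
  exfalso
  have hbound : ∀ᵐ z ∂(MeasureTheory.volume.restrict (Literature.Analysis.FluidPDE.parabolicCylinder r (T, xs))),
      ‖Function.uncurry u z‖ ≤ C := by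
    filter_upwards [MeasureTheory.ae_restrict_mem
      (Literature.Analysis.FluidPDE.isOpen_parabolicCylinder r (T, xs)).measurableSet] with z hz
    rw [Literature.Analysis.FluidPDE.mem_parabolicCylinder] at hz
    exact hC z.1 hz.1 z.2 hz.2
  have hlt : MeasureTheory.eLpNorm (Function.uncurry u) ⊤
      (MeasureTheory.volume.restrict (Literature.Analysis.FluidPDE.parabolicCylinder r (T, xs))) < ⊤ := by
    rw [MeasureTheory.eLpNorm_exponent_top]
    exact MeasureTheory.eLpNormEssSup_lt_top_of_ae_bound hbound
  exact hlt.ne (hxs r hr)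

end Summit.NavierStokesRegularity.NavierStokesRegularity.Theses.RootDecompMorreyBudget
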